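import Summits.PneNP.PneNP.Theorems.ConvexRankGatesCliqueExtLowerBoundWidthThresholdDefs
import Summits.PneNP.PneNP.Theorems.ConvexRankGatesCliqueExtLowerBoundStubEngine
import Summits.PneNP.PneNP.Theorems.ConvexRankGatesCliqueExtLowerBoundStubReferee
import Summits.PneNP.PneNP.Theorems.ConvexRankGatesCliqueExtLowerBoundStubInline
import Summits.PneNP.PneNP.Theorems.ConvexRankGatesCliqueExtLowerBoundStubNarrowAlgebraic
import Summits.PneNP.PneNP.Theorems.CliqueExtLowerBound.Negative.LoadBearing

/-!
# The NARROW extended-monotone lower bound for CLIQUE (line `width-threshold-certificate-sparsity`,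
crux `CliqueExtLowerBound`, stmt-PneNP-10682, route PneNP/ConvexRankGates)

**Theorem (`narrowLowerBound`).** For every `c`, eventually in `m`, no circuit with at most `m^c`
gates over the basis `{∧₂, ∨₂} ∪ PERM_{T(m)} ∪ GRANK_{T(m)}`, `T(m) = ⌊m^{1/16}⌋₊`, computes
`CLIQUE(m, ⌈m^{1/4}⌉₊)` — Razborov/Alon–Boppana's monotone lower bound extended to permutation-group
membership gates (Furst–Hopcroft–Luks) and generic-rank threshold gates (Edmonds) of dimension up to
`m^{1/16}`, of ANY fan-in, freely interleaved with `∧/∨`. It is the width threshold of the line as a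
TIGHTNESS LEMMA for the crux: any counterexample to `CliqueExtLowerBound` at `δ = 1/4` must use a CONV
gate or an algebraic gate wider than `⌊m^{1/16}⌋₊` (cf. the disprover's one-gate kills, all of width
`≥ C(m,k)`).

**Proof** (composition only; the mathematics is in the four landed stub files): Jukna's two-sided
CNF/DNF approximation (Jukna 2012 §9.4, Thm 9.17) in EVENT CURRENCY — `stub_engine` (the induction
along the circuit with pluggable monotone gates), `stub_inline` (a `{∧₂,∨₂,0,1}`-sub-circuit fed with
local pairs is free: here only `∧₂`, `∨₂` themselves, at monotone complexity `m^0`), `stub_narrowAlgebraic`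
(PERM/GRANK gates of width `≤ ⌊m^{1/16}⌋₊` are sandwichable in the worst case: short minterms, one
switching up and one down), `stub_referee` (the pair bare `⌈m^{1/4}⌉₊`-cliques / complements of the
`#E/⌊m^{1/8}⌋₊`-edge graphs is nondegenerate) — combined by `core` (both exits of the engine are
absurd on the referee pair). Vocabulary and currency lemmas: `…WidthThresholdDefs` (`posFam`, `negFam`, `eps`, `kk`, `TT`,
`Sandwichable`, `Replaceable`, `InlineFree`, `sandwichable_of_replaceable`, …).

References: S. Jukna, *Boolean Function Complexity* (2012), §9.3–9.4 [Jukna2012]; A. A. Razborov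
(1985) [Razborov1985]; N. Alon, R. Boppana (1987) [AlonBoppana1987].
-/

set_option linter.dupNamespace false

open Literature.Computability.Complexity Filter Finset
open Summit.PneNP.PneNP.Theorems.CliqueExtLowerBound.Negative (ceil_rpow_le)

noncomputable section

namespace Summit.PneNP.PneNP.Theorems.CliqueExtLowerBound.WidthThreshold

/-! ## The four landed stubs, read in the line's vocabulary (definitional unfolding) -/

/-- `stub_referee` in the line's vocabulary. [folklore] -/
theorem referee_statement : ∀ s : ℕ, ∀ᶠ m : ℕ in atTop,
    4 * #((negFam m).filter fun x => cliqueFn m (kk m) x = true) ≤ #(negFam m) ∧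
    ∀ q : Finset (EV m), #q ≤ s →
      4 * #((posFam m).filter fun x => ∃ e ∈ q, x e = true) ≤ #(posFam m) :=
  Referee.stub_referee

/-- `stub_inline` in the line's vocabulary. [folklore] -/
theorem inline_statement : ∀ a c : ℕ, ∃ r₀ s₀ : ℕ, 2 ≤ r₀ ∧ 2 ≤ s₀ ∧ ∀ r s : ℕ, r₀ ≤ r → s₀ ≤ s →
    ∀ᶠ m : ℕ in atTop, InlineFree r s (m ^ a) (posFam m) (negFam m) (eps m c) :=
  Inline.stub_inline

/-- `stub_narrowAlgebraic` in the line's vocabulary. [folklore] -/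
theorem narrowAlgebraic_statement : ∀ c : ℕ, ∃ r₀ s₀ : ℕ, 2 ≤ r₀ ∧ 2 ≤ s₀ ∧ ∀ r s : ℕ,
    r₀ ≤ r → s₀ ≤ s → ∀ᶠ m : ℕ in atTop, ∀ φ : GateFn, (IsPermGate (TT m) φ ∨ IsGRankGate (TT m) φ) →
      Sandwichable r s (m ^ (c + 3)) (posFam m) (negFam m) (eps m c) φ :=
  NarrowAlgebraic.stub_narrowAlgebraic

/-! ## §6 The per-`m` core and the composition -/

/-- Positives are accepted by `CLIQUE(m, k)`. -/
theorem cliqueFn_of_mem_posFam {m : ℕ} {x : EV m → Bool} (hx : x ∈ posFam m) :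
    cliqueFn m (kk m) x = true :=
  cliqueFn_of_mem_posGraphs hx

/-- There are positives as soon as `1 ≤ m` (`k ≤ m`). -/
theorem posFam_card_pos {m : ℕ} (hm : 1 ≤ m) : 0 < #(posFam m) := by
  refine Finset.card_pos.2 (posGraphs_nonempty ?_)
  exact ceil_rpow_le (δ := 1 / 4) (by norm_num) hm

/-- There are negatives (always: `t ≤ #E`). -/
theorem negFam_card_pos (m : ℕ) : 0 < #(negFam m) := by
  refine Finset.card_pos.2 (Finset.Nonempty.image ?_ _)
  rw [Finset.powersetCard_nonempty, Finset.card_univ]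
  exact Nat.div_le_self _ _

/-- Size bookkeeping: `#E(K_m) + m^c + 1 ≤ m^{c+3}` for `m ≥ 3`. -/
theorem card_EV_add_le {m : ℕ} (hm : 3 ≤ m) (c : ℕ) :
    Fintype.card (EV m) + m ^ c + 1 ≤ m ^ (c + 3) := by
  have h1 : 1 ≤ m := by omega
  have hE : Fintype.card (EV m) ≤ m ^ (c + 2) := by
    calc Fintype.card (EV m)
        ≤ Fintype.card (Sym2 (Fin m)) := Fintype.card_le_of_injective Subtype.val Subtype.val_injective
      _ ≤ Fintype.card (Fin m × Fin m) :=
          Fintype.card_le_of_surjective (Sym2.mk (α := Fin m)).uncurry Sym2.mk_surjective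
      _ = m ^ 2 := by simp [sq]
      _ ≤ m ^ (c + 2) := Nat.pow_le_pow_right h1 (by omega)
  have hc : m ^ c ≤ m ^ (c + 2) := Nat.pow_le_pow_right h1 (by omega)
  have h2 : 1 ≤ m ^ (c + 2) := Nat.one_le_pow _ _ h1
  calc Fintype.card (EV m) + m ^ c + 1 ≤ 3 * m ^ (c + 2) := by omega
    _ ≤ m * m ^ (c + 2) := Nat.mul_le_mul_right _ hm
    _ = m ^ (c + 3) := by ring

/-- Error bookkeeping: `size · 2ε(m,c) ≤ 1/4` for `size ≤ m^c`, `m ≥ 1`. -/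
theorem size_mul_eps_le {m c sz : ℕ} (hm : 1 ≤ m) (hsz : sz ≤ m ^ c) :
    (sz : ℝ) * (2 * eps m c) ≤ 1 / 4 := by
  have hm' : (1 : ℝ) ≤ m := by exact_mod_cast hm
  have hmpos : (0 : ℝ) < (m : ℝ) ^ c := by positivity
  have hsz' : (sz : ℝ) ≤ (m : ℝ) ^ c := by exact_mod_cast hsz
  have hpow : (m : ℝ) ^ c ≤ (m : ℝ) ^ (c + 1) := by
    rw [pow_succ]
    exact le_mul_of_one_le_right hmpos.le hm'
  have hpos : (0 : ℝ) < 8 * (m : ℝ) ^ (c + 1) := by positivity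
  unfold eps
  rw [show (sz : ℝ) * (2 * (1 / (8 * (m : ℝ) ^ (c + 1)))) = sz / (4 * (m : ℝ) ^ (c + 1)) by
    field_simp; ring]
  rw [div_le_div_iff₀ (by positivity) (by norm_num)]
  nlinarith

/-- THE PER-`m` CORE: if every gate of a monotone basis `B` is sandwichable on the referee pair with error
`2ε(m,c)` and the referee pair is nondegenerate at locality `s`, then no `B`-circuit with `≤ m^c` gates
computes `CLIQUE(m, k(m))` — the engine's two exits are both absurd. -/
theorem core {m c r s : ℕ} (hr : 2 ≤ r) (hs : 2 ≤ s) (hm : 3 ≤ m)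
    (href₁ : 4 * #((negFam m).filter fun x => cliqueFn m (kk m) x = true) ≤ #(negFam m))
    (href₂ : ∀ q : Finset (EV m), #q ≤ s →
      4 * #((posFam m).filter fun x => ∃ e ∈ q, x e = true) ≤ #(posFam m))
    {B : Set GateFn} (hBmono : ∀ φ ∈ B, Monotone φ.2)
    (hgates : ∀ φ ∈ B, Sandwichable r s (m ^ (c + 3)) (posFam m) (negFam m) (2 * eps m c) φ)
    (C : Circuit (EV m)) (hC : C.IsOver B) (hsize : C.size ≤ m ^ c) :
    ¬ C.Computes (cliqueFn m (kk m)) := by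
  classical
  intro hcomp
  have h1 : 1 ≤ m := by omega
  have hε : (0 : ℝ) ≤ 2 * eps m c := by unfold eps; positivity
  have hA : Fintype.card (EV m) + C.size + 1 ≤ m ^ (c + 3) :=
    le_trans (by omega) (card_EV_add_le hm c)
  have key := Engine.stub_engine (EV m) r s (m ^ (c + 3)) hr hs (posFam m) (negFam m) (2 * eps m c) hε C
    hA (fun g hg => hBmono g.fn (hC g hg)) (fun g hg => hgates g.fn (hC g hg))
    (cliqueFn m (kk m)) hcomp
  have hq : (C.size : ℝ) * (2 * eps m c) ≤ 1 / 4 := size_mul_eps_le h1 hsize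
  have hPpos : (0 : ℝ) < #(posFam m) := by exact_mod_cast posFam_card_pos h1
  have hNpos : (0 : ℝ) < #(negFam m) := by exact_mod_cast negFam_card_pos m
  rcases key with h | ⟨q, hqs, h⟩
  · -- exit 1: almost every negative would contain a `k`-clique
    have hsplit : #((negFam m).filter fun x => cliqueFn m (kk m) x = true) +
        #((negFam m).filter fun x => cliqueFn m (kk m) x = false) = #(negFam m) := by
      have := card_filter_add_card_filter_not
        (s := negFam m) (p := fun x => cliqueFn m (kk m) x = true)
      rw [← this]
      congr 1
      exact congrArg card (filter_congr fun x _ => by simp)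
    have e1 : (#((negFam m).filter fun x => cliqueFn m (kk m) x = true) : ℝ) +
        #((negFam m).filter fun x => cliqueFn m (kk m) x = false) = #(negFam m) := by
      exact_mod_cast hsplit
    have e2 : 4 * (#((negFam m).filter fun x => cliqueFn m (kk m) x = true) : ℝ) ≤ #(negFam m) := by
      exact_mod_cast href₁
    have e3 : (#((negFam m).filter fun x => cliqueFn m (kk m) x = false) : ℝ) ≤ #(negFam m) / 4 := by
      refine h.trans ?_
      have := mul_le_mul_of_nonneg_right hq hNpos.le
      linarith
    linarith
  · -- exit 2: almost every bare clique would meet a fixed set of fewer than `s` edges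
    have hall : ∀ x ∈ posFam m, cliqueFn m (kk m) x = true := fun x hx => cliqueFn_of_mem_posFam hx
    have hsplit : #((posFam m).filter fun x => ∃ e ∈ q, x e = true) +
        #((posFam m).filter fun x => cliqueFn m (kk m) x = true ∧ ∀ e ∈ q, x e = false) =
          #(posFam m) := by
      have := card_filter_add_card_filter_not
        (s := posFam m) (p := fun x => ∃ e ∈ q, x e = true)
      rw [← this]
      congr 1
      refine congrArg card (filter_congr fun x hx => ?_)
      simp only [hall x hx, true_and, not_exists, not_and, Bool.not_eq_true]
    have e1 : (#((posFam m).filter fun x => ∃ e ∈ q, x e = true) : ℝ) +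
        #((posFam m).filter fun x => cliqueFn m (kk m) x = true ∧ ∀ e ∈ q, x e = false) =
          #(posFam m) := by
      exact_mod_cast hsplit
    have e2 : 4 * (#((posFam m).filter fun x => ∃ e ∈ q, x e = true) : ℝ) ≤ #(posFam m) := by
      exact_mod_cast href₂ q (by omega)
    have e3 : (#((posFam m).filter fun x => cliqueFn m (kk m) x = true ∧ ∀ e ∈ q, x e = false) : ℝ)
        ≤ #(posFam m) / 4 := by
      refine h.trans ?_
      have := mul_le_mul_of_nonneg_right hq hPpos.le
      linarith
    linarith

/-- **THE NARROW LOWER BOUND.** For every `c`, eventually in `m`, no circuit with `≤ m^c` gates over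
`{∧₂, ∨₂} ∪ PERM_{⌊m^{1/16}⌋₊} ∪ GRANK_{⌊m^{1/16}⌋₊}` computes `CLIQUE(m, ⌈m^{1/4}⌉₊)`: pick `r, s` as
maxima of the thresholds of `stub_inline` (at monotone complexity `m^0`, for `∧₂, ∨₂` replace
themselves) and `stub_narrowAlgebraic`, intersect the eventualities with `stub_referee`, and run
`core`. [cite: Jukna2012, Thm. 9.17] -/
theorem narrowLowerBound (c : ℕ) : ∀ᶠ m : ℕ in atTop, ∀ C : Circuit (EV m),
    C.IsOver (monotoneBasis ∪ {g | IsPermGate (TT m) g ∨ IsGRankGate (TT m) g}) →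
      C.size ≤ m ^ c → ¬ C.Computes (cliqueFn m (kk m)) := by
  obtain ⟨r₁, s₁, hr₁, hs₁, hI₁⟩ := inline_statement 0 c
  obtain ⟨r₃, s₃, hr₃, hs₃, hN⟩ := narrowAlgebraic_statement c
  set r := max r₁ r₃ with hr
  set s := max s₁ s₃ with hs
  have hr2 : 2 ≤ r := le_trans hr₁ (le_max_left _ _)
  have hs2 : 2 ≤ s := le_trans hs₁ (le_max_left _ _)
  have E₁ := hI₁ r s (le_max_left _ _) (le_max_left _ _)
  have E₃ := hN r s (le_max_right _ _) (le_max_right _ _)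
  have E₆ := referee_statement s
  filter_upwards [E₁, E₃, E₆, eventually_ge_atTop 3] with m h₁ h₃ h₆ hm C hC hsize
  have hε0 : 0 ≤ eps m c := by unfold eps; positivity
  have htwo : eps m c + eps m c = 2 * eps m c := by ring
  refine core hr2 hs2 hm h₆.1 h₆.2
    (B := monotoneBasis ∪ {g | IsPermGate (TT m) g ∨ IsGRankGate (TT m) g}) ?_ ?_ C hC hsize
  · rintro φ (hφ | hφ)
    · rcases hφ with rfl | rfl
      · exact GateFn.and_monotone 2
      · exact GateFn.or_monotone 2
    · rcases hφ with hφ | hφ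
      · exact hφ.monotone
      · exact hφ.monotone
  · rintro φ (hφ | hφ)
    · rw [pow_zero] at h₁
      exact htwo ▸ sandwichable_of_replaceable (replaceable_of_mem_monotoneBasis le_rfl hε0 hφ) h₁
    · exact (h₃ φ hφ).of_le (by linarith)

/-- The same, with every object of the line written out (`TT`, `kk`, `EV` unfolded): eventually in
`m`, no circuit with `≤ m^c` gates over `{∧₂, ∨₂} ∪ PERM_{⌊m^{1/16}⌋₊} ∪ GRANK_{⌊m^{1/16}⌋₊}` computes
`cliqueFn m ⌈m^{1/4}⌉₊`. [cite: Jukna2012, Thm. 9.17] -/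
theorem narrowLowerBound_explicit : ∀ c : ℕ, ∀ᶠ m : ℕ in atTop,
    ∀ C : Circuit ((⊤ : SimpleGraph (Fin m)).edgeSet),
      C.IsOver (monotoneBasis ∪
        {g | IsPermGate ⌊(m : ℝ) ^ (1 / 16 : ℝ)⌋₊ g ∨ IsGRankGate ⌊(m : ℝ) ^ (1 / 16 : ℝ)⌋₊ g}) →
      C.size ≤ m ^ c → ¬ C.Computes (cliqueFn m ⌈(m : ℝ) ^ (1 / 4 : ℝ)⌉₊) :=
  narrowLowerBound

end Summit.PneNP.PneNP.Theorems.CliqueExtLowerBound.WidthThreshold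

end
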